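import Mathlib.NumberTheory.LSeries.Linearity
import Literature.NumberTheory.LFunctions.GaussianHeckeNonvanishing
import Literature.NumberTheory.LFunctions.WienerIkeharaProofs
import HarnessLib

/-!
# `∑_{N(π)^j ≤ x} log N(π) λ^m(π)^j = o(x)` (`m ≥ 1`) and `ψ_{ℤ[i]}(x) ∼ x`, by Wiener–Ikehara

Topic `Literature/NumberTheory/LFunctions`.  Sixth brick of the proof of Hecke's theorem on
Gaussian primes in sectors (`Literature.NumberTheory.LFunctions.GaussianInt.hecke_gaussianPrimes_inSectors`):
the Tauberian step.  With the prime-power coefficients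
`l_m(n) = ∑_{(π,j) : N(π)^j = n} log N(π) λ^m(π)^j` (`GaussianHeckeVonMangoldt.lean`; `π` over
first-quadrant Gaussian primes) we PROVE, along the integers `N → ∞`,

* `sum_re_lCoeff_zero_sub_isLittleO` — the **prime ideal theorem for `ℤ[i]` in `ψ`-form**:
  `ψ_{ℤ[i]}(N) := ∑_{n ≤ N} l_0(n) = N + o(N)`;
* `sum_lCoeff_isLittleO` — for `m ≥ 1`: **`∑_{n ≤ N} l_m(n) = o(N)`**, i.e.
  `∑_{N(π)^j ≤ N} log N(π) λ^m(π)^j = o(N)` (Hecke 1920, §7, the `λ^m`-twisted prime ideal theorem).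

## Proof

The tree's Wiener–Ikehara theorem `Literature.NumberTheory.LFunctions.WienerIkehara_holds`
(Montgomery–Vaughan Cor. 8.8) is applied to the three Dirichlet series with NONNEGATIVE
coefficients `l_0(n)`, `2 l_0(n) + l_m(n) + \overline{l_m(n)} = ∑ log N(π) (2 + 2 Re λ^m(π)^j)` and
`2 l_0(n) - i l_m(n) + i \overline{l_m(n)} = ∑ log N(π) (2 + 2 Im λ^m(π)^j)`, whose sums are
`P_0`, `2P_0 + P_m + P̃_m`, `2P_0 - iP_m + iP̃_m` (`P̃_m(s) = \overline{P_m(s̄)}`); the required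
continuous extensions to `Re s ≥ 1` of `P_0 - 1/(s-1) = -H'/H` and `P_m = -D_m'/D_m` come from the
holomorphy of `H = (s-1) D_0`, `D_m` (`GaussianHeckeThetaMellin.lean`) and their NON-VANISHING on
`Re s ≥ 1` (`GaussianHeckeNonvanishing.lean`).  Subtracting gives `∑ Re l_m`, `∑ Im l_m = o(N)`.

## References

* E. Hecke, *Eine neue Art von Zetafunktionen und ihre Beziehungen zur Verteilung der
  Primzahlen. II*, Math. Z. 6 (1920), 11–51, §7. [HeckeMathZ1920]
* H. L. Montgomery, R. C. Vaughan, *Multiplicative Number Theory I*, CUP 2007, Cor. 8.8.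
  [MontgomeryVaughan2007]
-/

noncomputable section

open Complex Filter Topology Asymptotics Finset LSeries
open scoped ComplexConjugate

namespace Literature.NumberTheory.LFunctions

namespace GaussianHecke

open GaussianInt GaussianTheta

local notation "ℤ[i]" => _root_.GaussianInt

open scoped Classical

/-! ### The logarithmic derivatives `-D_m'/D_m` and `-H'/H` on `Re s ≥ 1` -/

/-- `G_m(s) = -D_m'(s)/D_m(s)` (`= P_m(s)` for `Re s > 1`). [folklore] -/
def logDerivL (m : ℕ) (s : ℂ) : ℂ := -deriv (heckeL m) s / heckeL m s

/-- `G_m` is continuous on `Re s ≥ 1` for `m ≥ 1` (`D_m` entire and zero-free there). [folklore] -/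
theorem continuousOn_logDerivL {m : ℕ} (hm : m ≠ 0) :
    ContinuousOn (logDerivL m) {s : ℂ | 1 ≤ s.re} := by
  have hD := differentiable_heckeL hm
  show ContinuousOn (fun s ↦ -deriv (heckeL m) s / heckeL m s) _
  refine ContinuousOn.div ?_ hD.continuous.continuousOn fun s hs ↦ heckeL_ne_zero_of_one_le_re hm hs
  exact (hD.deriv.continuous.neg).continuousOn

/-- For `Re s > 1`, `G_m(s) = P_m(s)`. [folklore] -/
theorem logDerivL_eq_heckeP (m : ℕ) {s : ℂ} (hs : 1 < s.re) : logDerivL m s = heckeP m s :=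
  (heckeP_eq_neg_deriv_div m hs).symm

/-- `G_0^H(s) = -H'(s)/H(s)`, `H = (s - 1) D_0` (`= P_0(s) - 1/(s-1)` for `Re s > 1`). [folklore] -/
def logDerivH (s : ℂ) : ℂ := -deriv heckeH s / heckeH s

/-- `H(s) ≠ 0` for `Re s ≥ 1` (`H(1) = π`, `H(s) = (s-1) D_0(s)` otherwise). [folklore] -/
theorem heckeH_ne_zero {s : ℂ} (hs : 1 ≤ s.re) : heckeH s ≠ 0 := by
  rcases eq_or_ne s 1 with rfl | hs1
  · rw [heckeH_one]; exact ofReal_ne_zero.mpr Real.pi_ne_zero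
  · rw [heckeH_eq hs1]
    exact mul_ne_zero (sub_ne_zero.mpr hs1) (heckeL_zero_ne_zero_of_one_le_re hs hs1)

/-- `-H'/H` is continuous on `Re s ≥ 1`. [folklore] -/
theorem continuousOn_logDerivH : ContinuousOn logDerivH {s : ℂ | 1 ≤ s.re} := by
  have hU : IsOpen {s : ℂ | s ≠ 0} := isOpen_ne
  have hdiff : DifferentiableOn ℂ heckeH {s : ℂ | s ≠ 0} := fun s hs ↦
    (differentiableAt_heckeH hs).differentiableWithinAt
  have hsub : {s : ℂ | 1 ≤ s.re} ⊆ {s : ℂ | s ≠ 0} := fun s hs h0 ↦ by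
    simp only [Set.mem_setOf_eq, h0, zero_re] at hs
    linarith
  show ContinuousOn (fun s ↦ -deriv heckeH s / heckeH s) _
  refine ContinuousOn.div ?_ (hdiff.continuousOn.mono hsub) fun s hs ↦ heckeH_ne_zero hs
  exact ((hdiff.deriv hU).continuousOn.mono hsub).neg

/-- For `Re s > 1`: `P_0(s) = -H'(s)/H(s) + 1/(s-1)`. [folklore] -/
theorem heckeP_zero_eq {s : ℂ} (hs : 1 < s.re) : heckeP 0 s = logDerivH s + 1 / (s - 1) := by
  have hs1 : s ≠ 1 := fun h ↦ by rw [h, one_re] at hs; exact lt_irrefl _ hs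
  have hs0 : s ≠ 0 := fun h ↦ by rw [h, zero_re] at hs; linarith
  have hs1' : s - 1 ≠ 0 := sub_ne_zero.mpr hs1
  have hH : heckeH s ≠ 0 := heckeH_ne_zero hs.le
  -- `D_0 = H/(z-1)` near `s`, so `D_0'(s) = (H'(s)(s-1) - H(s))/(s-1)²`
  have hHd : HasDerivAt heckeH (deriv heckeH s) s := (differentiableAt_heckeH hs0).hasDerivAt
  have hq : HasDerivAt (fun z ↦ heckeH z / (z - 1))
      ((deriv heckeH s * (s - 1) - heckeH s * 1) / (s - 1) ^ 2) s :=
    hHd.div (hasDerivAt_id s |>.sub_const 1) hs1'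
  have hev : heckeL 0 =ᶠ[𝓝 s] fun z ↦ heckeH z / (z - 1) := by
    filter_upwards [isOpen_ne.mem_nhds hs1] with z hz
    rw [heckeH_eq hz, mul_div_cancel_left₀ _ (sub_ne_zero.mpr hz)]
  have hD : deriv (heckeL 0) s = (deriv heckeH s * (s - 1) - heckeH s * 1) / (s - 1) ^ 2 :=
    (hq.congr_of_eventuallyEq hev).deriv
  rw [heckeP_eq_neg_deriv_div 0 hs, hD, logDerivH,
    show heckeL 0 s = heckeH s / (s - 1) from hev.self_of_nhds]
  field_simp
  ring

/-! ### Conjugate series -/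

/-- `LSeries (conj ∘ f) s = conj (LSeries f (conj s))` (twin of
`Literature.NumberTheory.EllipticCurves.ModularForms.LSeries_conj`, restated here so as not to import
the modular-forms development into this file). [folklore] -/
theorem LSeries_conj (f : ℕ → ℂ) (s : ℂ) :
    LSeries (fun n ↦ conj (f n)) s = conj (LSeries f (conj s)) := by
  rw [LSeries, LSeries, Complex.conj_tsum]
  refine tsum_congr fun n ↦ ?_
  rcases eq_or_ne n 0 with rfl | hn
  · simp
  · rw [term_of_ne_zero hn, term_of_ne_zero hn, map_div₀]
    congr 1
    have h := conj_cpow (n : ℂ) s (by rw [natCast_arg]; exact Real.pi_ne_zero.symm)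
    rw [map_natCast] at h
    exact h

/-- `LSeriesSummable (conj ∘ f) s ↔` from `LSeriesSummable f (conj s)`. [folklore] -/
theorem LSeriesSummable_conj {f : ℕ → ℂ} {s : ℂ} (h : LSeriesSummable f (conj s)) :
    LSeriesSummable (fun n ↦ conj (f n)) s := by
  refine (h.norm.of_norm_bounded fun n ↦ le_of_eq ?_)
  rw [norm_term_eq, norm_term_eq]
  simp only [Complex.norm_conj, conj_re]

/-! ### The nonnegative coefficient sequences -/

/-- `a⁺_m(n) = ∑_{(π,j) : N(π)^j = n} log N(π) (2 + 2 Re λ^m(π)^j) ≥ 0`. [folklore] -/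
def coeffRe (m n : ℕ) : ℝ :=
  ∑ p ∈ pairsNorm n, Real.log (p.1.norm : ℝ) * (2 + 2 * (angularChar m p.1 ^ p.2).re)

/-- `a⁻_m(n) = ∑_{(π,j) : N(π)^j = n} log N(π) (2 + 2 Im λ^m(π)^j) ≥ 0`. [folklore] -/
def coeffIm (m n : ℕ) : ℝ :=
  ∑ p ∈ pairsNorm n, Real.log (p.1.norm : ℝ) * (2 + 2 * (angularChar m p.1 ^ p.2).im)

/-- `a⁰(n) = ∑_{(π,j) : N(π)^j = n} log N(π) = l_0(n) ≥ 0` (the von Mangoldt function of `ℤ[i]`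
summed over norms). [folklore] -/
def coeffZero (n : ℕ) : ℝ := ∑ p ∈ pairsNorm n, Real.log (p.1.norm : ℝ)

/-- `log N(π) ≥ 0` on `pairsNorm`. [folklore] -/
theorem log_norm_nonneg_of_mem {n : ℕ} {p : ℤ[i] × ℕ} (hp : p ∈ pairsNorm n) :
    0 ≤ Real.log (p.1.norm : ℝ) := by
  have h2 := two_le_norm_of_prime (mem_primesQ1.mp (mem_pairsNorm.mp hp).1).1
  exact Real.log_nonneg (by exact_mod_cast (by omega : (1 : ℤ) ≤ p.1.norm))

/-- `|λ^m(π)^j| = 1` on `pairsNorm`. [folklore] -/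
theorem norm_angularChar_pow_of_mem (m : ℕ) {n : ℕ} {p : ℤ[i] × ℕ} (hp : p ∈ pairsNorm n) :
    ‖angularChar m p.1 ^ p.2‖ = 1 := by
  rw [norm_pow, norm_angularChar (mem_primesQ1.mp (mem_pairsNorm.mp hp).1).1.ne_zero, one_pow]

/-- `a⁺_m(n) ≥ 0`. [folklore] -/
theorem coeffRe_nonneg (m n : ℕ) : 0 ≤ coeffRe m n := by
  refine sum_nonneg fun p hp ↦ mul_nonneg (log_norm_nonneg_of_mem hp) ?_
  have := (abs_re_le_norm (angularChar m p.1 ^ p.2)).trans_eq (norm_angularChar_pow_of_mem m hp)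
  linarith [(abs_le.mp this).1]

/-- `a⁻_m(n) ≥ 0`. [folklore] -/
theorem coeffIm_nonneg (m n : ℕ) : 0 ≤ coeffIm m n := by
  refine sum_nonneg fun p hp ↦ mul_nonneg (log_norm_nonneg_of_mem hp) ?_
  have := (abs_im_le_norm (angularChar m p.1 ^ p.2)).trans_eq (norm_angularChar_pow_of_mem m hp)
  linarith [(abs_le.mp this).1]

/-- `a⁰(n) ≥ 0`. [folklore] -/
theorem coeffZero_nonneg (n : ℕ) : 0 ≤ coeffZero n :=
  sum_nonneg fun _ hp ↦ log_norm_nonneg_of_mem hp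

/-- `a⁰(n) = l_0(n)` (as complex numbers). [folklore] -/
theorem coeffZero_eq (n : ℕ) : (coeffZero n : ℂ) = lCoeff 0 n := by
  rw [coeffZero, lCoeff, ofReal_sum]
  refine sum_congr rfl fun p _ ↦ ?_
  rw [angularChar_zero_left, one_pow, mul_one]

/-- `a⁺_m(n) = 2 l_0(n) + l_m(n) + \overline{l_m(n)}`. [folklore] -/
theorem coeffRe_eq (m n : ℕ) :
    (coeffRe m n : ℂ) = 2 * lCoeff 0 n + lCoeff m n + conj (lCoeff m n) := by
  rw [coeffRe, lCoeff, lCoeff, map_sum, ofReal_sum, mul_sum, ← sum_add_distrib, ← sum_add_distrib]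
  refine sum_congr rfl fun p _ ↦ ?_
  have hw : angularChar m p.1 ^ p.2 + conj (angularChar m p.1 ^ p.2) =
      2 * ((angularChar m p.1 ^ p.2).re : ℂ) := by
    rw [Complex.add_conj, ofReal_mul, ofReal_ofNat]
  rw [angularChar_zero_left, one_pow, mul_one, map_mul, conj_ofReal]
  push_cast
  linear_combination -(Real.log (p.1.norm : ℝ) : ℂ) * hw

/-- `a⁻_m(n) = 2 l_0(n) - i l_m(n) + i \overline{l_m(n)}`. [folklore] -/
theorem coeffIm_eq (m n : ℕ) :
    (coeffIm m n : ℂ) = 2 * lCoeff 0 n - I * lCoeff m n + I * conj (lCoeff m n) := by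
  rw [coeffIm, lCoeff, lCoeff, map_sum, ofReal_sum, mul_sum, mul_sum, mul_sum, ← sum_sub_distrib,
    ← sum_add_distrib]
  refine sum_congr rfl fun p _ ↦ ?_
  have hw : angularChar m p.1 ^ p.2 - conj (angularChar m p.1 ^ p.2) =
      2 * ((angularChar m p.1 ^ p.2).im : ℂ) * I := by
    rw [Complex.sub_conj, ofReal_mul, ofReal_ofNat]
  rw [angularChar_zero_left, one_pow, mul_one, map_mul, conj_ofReal]
  push_cast
  linear_combination (I * (Real.log (p.1.norm : ℝ) : ℂ)) * hw +
    (2 * (Real.log (p.1.norm : ℝ) : ℂ) * ((angularChar m p.1 ^ p.2).im : ℂ)) * I_sq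

/-! ### `L`-series of the coefficient sequences -/

/-- `LSeries a⁰ = P_0` for `Re s > 1`, and summability. [folklore] -/
theorem LSeries_coeffZero {s : ℂ} (hs : 1 < s.re) :
    LSeriesSummable (fun n ↦ (coeffZero n : ℂ)) s ∧
      LSeries (fun n ↦ (coeffZero n : ℂ)) s = heckeP 0 s := by
  have heq : (fun n ↦ (coeffZero n : ℂ)) = lCoeff 0 := funext coeffZero_eq
  rw [heq]
  exact ⟨LSeriesSummable_lCoeff 0 hs, rfl⟩

/-- `LSeries a⁺_m = 2 P_0 + P_m + P̃_m` for `Re s > 1` (`P̃_m(s) = \overline{P_m(s̄)}`), and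
summability. [folklore] -/
theorem LSeries_coeffRe (m : ℕ) {s : ℂ} (hs : 1 < s.re) :
    LSeriesSummable (fun n ↦ (coeffRe m n : ℂ)) s ∧
      LSeries (fun n ↦ (coeffRe m n : ℂ)) s =
        2 * heckeP 0 s + heckeP m s + conj (heckeP m (conj s)) := by
  have hs' : 1 < (conj s).re := by rwa [conj_re]
  have h0 := LSeriesSummable_lCoeff 0 hs
  have hm := LSeriesSummable_lCoeff m hs
  have hc : LSeriesSummable (fun n ↦ conj (lCoeff m n)) s := LSeriesSummable_conj (LSeriesSummable_lCoeff m hs')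
  have heq : (fun n ↦ (coeffRe m n : ℂ)) = fun n ↦ 2 * lCoeff 0 n + lCoeff m n + conj (lCoeff m n) :=
    funext (coeffRe_eq m)
  have hsum : LSeriesHasSum (fun n ↦ (coeffRe m n : ℂ)) s
      (2 * heckeP 0 s + heckeP m s + LSeries (fun n ↦ conj (lCoeff m n)) s) := by
    rw [heq]
    have h := ((h0.LSeriesHasSum.smul 2).add hm.LSeriesHasSum).add hc.LSeriesHasSum
    simpa only [Pi.add_def, Pi.smul_def, smul_eq_mul, heckeP] using h
  refine ⟨hsum.LSeriesSummable, ?_⟩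
  rw [hsum.LSeries_eq, LSeries_conj]
  rfl

/-- `LSeries a⁻_m = 2 P_0 - i P_m + i P̃_m` for `Re s > 1`, and summability. [folklore] -/
theorem LSeries_coeffIm (m : ℕ) {s : ℂ} (hs : 1 < s.re) :
    LSeriesSummable (fun n ↦ (coeffIm m n : ℂ)) s ∧
      LSeries (fun n ↦ (coeffIm m n : ℂ)) s =
        2 * heckeP 0 s - I * heckeP m s + I * conj (heckeP m (conj s)) := by
  have hs' : 1 < (conj s).re := by rwa [conj_re]
  have h0 := LSeriesSummable_lCoeff 0 hs
  have hm := LSeriesSummable_lCoeff m hs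
  have hc : LSeriesSummable (fun n ↦ conj (lCoeff m n)) s := LSeriesSummable_conj (LSeriesSummable_lCoeff m hs')
  have heq : (fun n ↦ (coeffIm m n : ℂ)) =
      fun n ↦ 2 * lCoeff 0 n + (-I) * lCoeff m n + I * conj (lCoeff m n) := by
    funext n; rw [coeffIm_eq]; ring
  have hsum : LSeriesHasSum (fun n ↦ (coeffIm m n : ℂ)) s
      (2 * heckeP 0 s + (-I) * heckeP m s + I * LSeries (fun n ↦ conj (lCoeff m n)) s) := by
    rw [heq]
    have h := ((h0.LSeriesHasSum.smul 2).add (hm.LSeriesHasSum.smul (-I))).add (hc.LSeriesHasSum.smul I)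
    simpa only [Pi.add_def, Pi.smul_def, smul_eq_mul, heckeP] using h
  refine ⟨hsum.LSeriesSummable, ?_⟩
  rw [hsum.LSeries_eq, LSeries_conj]
  simp only [heckeP]
  ring

/-! ### The three applications of Wiener–Ikehara -/

/-- The conjugated log-derivative `s ↦ \overline{G_m(s̄)}` is continuous on `Re s ≥ 1` (`m ≥ 1`).
[folklore] -/
theorem continuousOn_conj_logDerivL {m : ℕ} (hm : m ≠ 0) :
    ContinuousOn (fun s ↦ conj (logDerivL m (conj s))) {s : ℂ | 1 ≤ s.re} := by
  refine (Complex.continuous_conj.comp_continuousOn ((continuousOn_logDerivL hm).comp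
    Complex.continuous_conj.continuousOn fun s hs ↦ ?_))
  simpa using hs

/-- **Prime ideal theorem for `ℤ[i]`, `ψ`-form**: `∑_{n ≤ N} a⁰(n) - N = o(N)`, i.e.
`∑_{N(π)^j ≤ N} log N(π) = N + o(N)` (`π` over first-quadrant Gaussian primes; Landau 1903,
here via Wiener–Ikehara). [cite: MontgomeryVaughan2007, Cor. 8.8] -/
theorem sum_coeffZero_sub_isLittleO :
    (fun N : ℕ ↦ ∑ n ∈ Icc 1 N, coeffZero n - 1 * N) =o[atTop] fun N : ℕ ↦ (N : ℝ) := by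
  refine WienerIkehara_holds _ 1 coeffZero_nonneg (fun s hs ↦ (LSeries_coeffZero hs).1)
    ⟨logDerivH, continuousOn_logDerivH, fun s hs ↦ ?_⟩
  rw [(LSeries_coeffZero hs).2, heckeP_zero_eq hs]
  push_cast
  ring

/-- `∑_{n ≤ N} a⁺_m(n) - 2N = o(N)` for `m ≥ 1`. [cite: MontgomeryVaughan2007, Cor. 8.8] -/
theorem sum_coeffRe_sub_isLittleO {m : ℕ} (hm : m ≠ 0) :
    (fun N : ℕ ↦ ∑ n ∈ Icc 1 N, coeffRe m n - 2 * N) =o[atTop] fun N : ℕ ↦ (N : ℝ) := by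
  refine WienerIkehara_holds _ 2 (coeffRe_nonneg m) (fun s hs ↦ (LSeries_coeffRe m hs).1)
    ⟨fun s ↦ 2 * logDerivH s + logDerivL m s + conj (logDerivL m (conj s)), ?_, fun s hs ↦ ?_⟩
  · exact ((continuousOn_logDerivH.const_smul (2 : ℂ)).add (continuousOn_logDerivL hm)).add
      (continuousOn_conj_logDerivL hm) |>.congr fun s _ ↦ by simp [smul_eq_mul]
  · have hs' : 1 < (conj s).re := by rwa [conj_re]
    dsimp only
    rw [(LSeries_coeffRe m hs).2, heckeP_zero_eq hs, logDerivL_eq_heckeP m hs,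
      logDerivL_eq_heckeP m hs']
    push_cast
    ring

/-- `∑_{n ≤ N} a⁻_m(n) - 2N = o(N)` for `m ≥ 1`. [cite: MontgomeryVaughan2007, Cor. 8.8] -/
theorem sum_coeffIm_sub_isLittleO {m : ℕ} (hm : m ≠ 0) :
    (fun N : ℕ ↦ ∑ n ∈ Icc 1 N, coeffIm m n - 2 * N) =o[atTop] fun N : ℕ ↦ (N : ℝ) := by
  refine WienerIkehara_holds _ 2 (coeffIm_nonneg m) (fun s hs ↦ (LSeries_coeffIm m hs).1)
    ⟨fun s ↦ 2 * logDerivH s - I * logDerivL m s + I * conj (logDerivL m (conj s)), ?_, fun s hs ↦ ?_⟩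
  · exact ((continuousOn_logDerivH.const_smul (2 : ℂ)).sub
      ((continuousOn_logDerivL hm).const_smul I)).add
      ((continuousOn_conj_logDerivL hm).const_smul I) |>.congr fun s _ ↦ by simp [smul_eq_mul]
  · have hs' : 1 < (conj s).re := by rwa [conj_re]
    dsimp only
    rw [(LSeries_coeffIm m hs).2, heckeP_zero_eq hs, logDerivL_eq_heckeP m hs,
      logDerivL_eq_heckeP m hs']
    push_cast
    ring

/-! ### Conclusion: `∑_{n ≤ N} l_m(n) = o(N)` for `m ≥ 1` -/

/-- `2 ∑ Re l_m = ∑ a⁺_m - 2 ∑ a⁰`. [folklore] -/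
theorem sum_re_lCoeff_eq (m N : ℕ) :
    ∑ n ∈ Icc 1 N, (lCoeff m n).re = (∑ n ∈ Icc 1 N, coeffRe m n - 2 * ∑ n ∈ Icc 1 N, coeffZero n) / 2 := by
  rw [mul_sum, ← sum_sub_distrib, eq_div_iff two_ne_zero, sum_mul]
  refine sum_congr rfl fun n _ ↦ ?_
  have h1 := congrArg Complex.re (coeffRe_eq m n)
  have h2 := congrArg Complex.re (coeffZero_eq n)
  simp only [ofReal_re, add_re, mul_re, re_ofNat, im_ofNat, zero_mul, sub_zero, conj_re] at h1 h2
  linarith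

/-- `2 ∑ Im l_m = ∑ a⁻_m - 2 ∑ a⁰`. [folklore] -/
theorem sum_im_lCoeff_eq (m N : ℕ) :
    ∑ n ∈ Icc 1 N, (lCoeff m n).im = (∑ n ∈ Icc 1 N, coeffIm m n - 2 * ∑ n ∈ Icc 1 N, coeffZero n) / 2 := by
  rw [mul_sum, ← sum_sub_distrib, eq_div_iff two_ne_zero, sum_mul]
  refine sum_congr rfl fun n _ ↦ ?_
  have h1 := congrArg Complex.re (coeffIm_eq m n)
  have h2 := congrArg Complex.re (coeffZero_eq n)
  simp only [ofReal_re, add_re, sub_re, mul_re, re_ofNat, im_ofNat, I_re, I_im, zero_mul,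
    one_mul, sub_zero, zero_sub, conj_re, conj_im] at h1 h2
  linarith

/-- **`∑_{n ≤ N} Re l_m(n) = o(N)`** for `m ≥ 1`. [cite: HeckeMathZ1920, §7] -/
theorem sum_re_lCoeff_isLittleO {m : ℕ} (hm : m ≠ 0) :
    (fun N : ℕ ↦ ∑ n ∈ Icc 1 N, (lCoeff m n).re) =o[atTop] fun N : ℕ ↦ (N : ℝ) := by
  have h := ((sum_coeffRe_sub_isLittleO hm).sub
    ((sum_coeffZero_sub_isLittleO).const_mul_left 2)).const_mul_left (1 / 2)
  refine h.congr' (Eventually.of_forall fun N ↦ ?_) EventuallyEq.rfl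
  dsimp only
  rw [sum_re_lCoeff_eq]
  ring

/-- **`∑_{n ≤ N} Im l_m(n) = o(N)`** for `m ≥ 1`. [cite: HeckeMathZ1920, §7] -/
theorem sum_im_lCoeff_isLittleO {m : ℕ} (hm : m ≠ 0) :
    (fun N : ℕ ↦ ∑ n ∈ Icc 1 N, (lCoeff m n).im) =o[atTop] fun N : ℕ ↦ (N : ℝ) := by
  have h := ((sum_coeffIm_sub_isLittleO hm).sub
    ((sum_coeffZero_sub_isLittleO).const_mul_left 2)).const_mul_left (1 / 2)
  refine h.congr' (Eventually.of_forall fun N ↦ ?_) EventuallyEq.rfl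
  dsimp only
  rw [sum_im_lCoeff_eq]
  ring

/-- **`∑_{n ≤ N} l_m(n) = o(N)` for `m ≥ 1`**: the `λ^m`-twisted prime ideal theorem for `ℤ[i]`
in `ψ`-form, `∑_{N(π)^j ≤ N} log N(π) λ^m(π)^j = o(N)` (Hecke 1920, §7). [cite: HeckeMathZ1920, §7] -/
theorem sum_lCoeff_isLittleO {m : ℕ} (hm : m ≠ 0) :
    (fun N : ℕ ↦ ∑ n ∈ Icc 1 N, lCoeff m n) =o[atTop] fun N : ℕ ↦ (N : ℝ) := by
  have hre : (fun N : ℕ ↦ (∑ n ∈ Icc 1 N, lCoeff m n).re) =o[atTop] fun N : ℕ ↦ (N : ℝ) := by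
    simpa only [re_sum] using sum_re_lCoeff_isLittleO hm
  have him : (fun N : ℕ ↦ (∑ n ∈ Icc 1 N, lCoeff m n).im) =o[atTop] fun N : ℕ ↦ (N : ℝ) := by
    simpa only [im_sum] using sum_im_lCoeff_isLittleO hm
  have h := hre.norm_left.add him.norm_left
  refine IsBigO.trans_isLittleO (IsBigO.of_bound 1 (Eventually.of_forall fun N ↦ ?_)) h
  rw [one_mul, Real.norm_of_nonneg (by positivity)]
  exact Complex.norm_le_abs_re_add_abs_im _

/-- **Prime ideal theorem for `ℤ[i]`** in `ψ`-form with the complex coefficients `l_0`: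
`∑_{n ≤ N} Re l_0(n) - N = o(N)` (and `Im l_0 = 0`). [cite: MontgomeryVaughan2007, Cor. 8.8] -/
theorem sum_re_lCoeff_zero_sub_isLittleO :
    (fun N : ℕ ↦ ∑ n ∈ Icc 1 N, (lCoeff 0 n).re - N) =o[atTop] fun N : ℕ ↦ (N : ℝ) := by
  refine sum_coeffZero_sub_isLittleO.congr' (Eventually.of_forall fun N ↦ ?_) EventuallyEq.rfl
  dsimp only
  rw [one_mul]
  congr 1
  refine sum_congr rfl fun n _ ↦ ?_
  have h2 := congrArg Complex.re (coeffZero_eq n)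
  rwa [ofReal_re] at h2

end GaussianHecke

end Literature.NumberTheory.LFunctions
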